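import Mathlib
import HarnessLib
import Summits.NavierStokesRegularity.NavierStokesRegularity.Theorems.LrcModEntire.Negative.TwistedColumnWindow
import Summits.NavierStokesRegularity.NavierStokesRegularity.Theorems.LrcModEntire.Negative.TwistedColumnGerms

/-!
# Crux K2 `PoloidalWindowRigidity` (stmt-NavierStokesRegularity-19708) — negative side: `stub_twisting` of skeleton
# lrc-jet v5 is FALSE without the Oseen-mild identity (M), even granted (F) + (A)

Negative-side support (refuter seat ns-regularity-refuter1, K-47; D-0081 §C).  Skeleton lrc-jet v5
(`Cruxes/PoloidalWindowRigidity/Lines/lrc_jet.lean`, sha16 59c25cf8892db72a) closes K2 from `stub_untwisted` (landed,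
`…Theorems.PoloidalWindowDoorPoloidalWindowRigidityStubUntwisted`) and `stub_twisting` (non-degenerate + slope clause +
twisting window ⇒ `¬ IsBackwardSingularPoint v 0`), the latter obtained from the promoted item `LrcModEntire`'s germ step.
The TWISTED (TH) COLUMN `twistProfile` of `…LrcModEntire.Negative.TwistedColumnODE/…/Window` satisfies every hypothesis of
`stub_twisting` except (M) — Type-I rate `C = 10`, continuity, divergence-free, poloidal, the pins, the slope clause, the
non-vanishing twist bracket — and moreover (F) the frozen constraint and (A) entire real-analytic slices, and it IS
backward-singular at the apex (`v(t, 0) = (0, 0, (−t)^{-1/2}/3)`).  Companion of `…Negative.UntwistedFalseWithoutMild`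
(the untwisted stub ∖ (M), Stuart column): (M) is the single load-bearing hypothesis of BOTH halves of lrc-jet v5.
WHAT THIS IS NOT: not a claim about Navier–Stokes regularity and not a refutation of K2 — (M) is deleted. [folklore]
-/

noncomputable section

-- the summit and its single sub-problem share the name (CONVENTIONS §1), as in every Theorems file
set_option linter.dupNamespace false

namespace Summit.NavierStokesRegularity.NavierStokesRegularity.Theorems.PoloidalWindowRigidity.Negative

open MeasureTheory Set Function Filter Topology Metric
open scoped RealInnerProductSpace InnerProductSpace
open Literature.Analysis Literature.Analysis.FluidPDE
open Summit.NavierStokesRegularity.NavierStokesRegularity.Theorems.LrcModEntire.Negative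

/-- **`stub_twisting` of skeleton lrc-jet v5 is FALSE without the Oseen-mild identity (M).**  The hypotheses are those of
`stub_twisting` VERBATIM with (M) deleted; the twisted (TH) column (`C = 10`, window `twistWindow`) satisfies all of them
and is backward-singular at the apex. [folklore] -/
theorem twisting_false_without_mild :
    ¬ (∀ (C : ℝ) (v : ℝ → EuclideanSpace ℝ (Fin 3) → EuclideanSpace ℝ (Fin 3)),
      Literature.Analysis.FluidPDE.HasTypeITimeDecay C v →
      ContinuousOn (Function.uncurry v) (Set.Iio (0 : ℝ) ×ˢ Set.univ) →
      (∀ t < 0, Literature.Analysis.FluidPDE.VectorCalculus.IsDivFree (v t)) →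
      (∀ s < 0, ∀ y, ⟪Literature.Analysis.FluidPDE.curl (v s) y, EuclideanSpace.single 2 1⟫_ℝ = 0) →
      ∀ W : Set (ℝ × EuclideanSpace ℝ (Fin 3)), IsOpen W → W.Nonempty → W ⊆ Set.Iio (0 : ℝ) ×ˢ Set.univ →
        (∀ z ∈ W, Literature.Analysis.FluidPDE.curl (v z.1) z.2 ≠ 0 ∧
          (fderiv ℝ (v z.1) z.2 (EuclideanSpace.single 0 1) 2 ≠ 0 ∨ fderiv ℝ (v z.1) z.2 (EuclideanSpace.single 1 1) 2 ≠ 0) ∧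
          (fderiv ℝ (v z.1) z.2 (EuclideanSpace.single 2 1) 0 ≠ 0 ∨ fderiv ℝ (v z.1) z.2 (EuclideanSpace.single 2 1) 1 ≠ 0)) →
        (∀ m : ℝ → ℝ, ∀ W₁ : Set (ℝ × EuclideanSpace ℝ (Fin 3)), W₁ ⊆ W → IsOpen W₁ → W₁.Nonempty →
          ∃ z ∈ W₁, ∃ b : Fin 3, b ≠ 2 ∧
            fderiv ℝ (v z.1) z.2 (EuclideanSpace.single 2 1) b ≠
              m z.1 * fderiv ℝ (v z.1) z.2 (EuclideanSpace.single b 1) 2) →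
        (∀ z ∈ W,
          fderiv ℝ (fun x => fderiv ℝ (v z.1) x (EuclideanSpace.single 2 1) 2) z.2 (EuclideanSpace.single 0 1) *
              fderiv ℝ (v z.1) z.2 (EuclideanSpace.single 1 1) 2 -
            fderiv ℝ (fun x => fderiv ℝ (v z.1) x (EuclideanSpace.single 2 1) 2) z.2 (EuclideanSpace.single 1 1) *
              fderiv ℝ (v z.1) z.2 (EuclideanSpace.single 0 1) 2 ≠ 0) →
        ¬ Literature.Analysis.FluidPDE.IsBackwardSingularPoint v 0) := by
  intro H
  exact H 10 twistProfile hasTypeITimeDecay_twistProfile continuousOn_twistProfile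
    (fun t _ => isDivFree_twistProfile t) (fun s _ y => poloidal_twistProfile s y) twistWindow isOpen_twistWindow
    twistWindow_nonempty twistWindow_subset twistProfile_pins
    (fun m W₁ hW₁ hW₁o hW₁n => twistProfile_slope_not_time_only m W₁ hW₁ hW₁o hW₁n)
    twistProfile_twist_ne_zero isBackwardSingularPoint_twistProfile

/-- **The same, EVEN GRANTED the frozen Clebsch structure and real-analytic slices** ((M) REPLACED by (F) the frozen
constraint and (A) real-analyticity of every slice, both consequences of (M) in the class): still false on the same
witness (`frozen_twistProfile`; analyticity of the slices from `…TwistedColumnField`'s one-variable lemmas). [folklore] -/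
theorem twisting_false_without_mild_frozen_analytic :
    ¬ (∀ (C : ℝ) (v : ℝ → EuclideanSpace ℝ (Fin 3) → EuclideanSpace ℝ (Fin 3)),
      Literature.Analysis.FluidPDE.HasTypeITimeDecay C v →
      ContinuousOn (Function.uncurry v) (Set.Iio (0 : ℝ) ×ˢ Set.univ) →
      (∀ t < 0, Literature.Analysis.FluidPDE.VectorCalculus.IsDivFree (v t)) →
      (∀ s < 0, ∀ y, ⟪Literature.Analysis.FluidPDE.curl (v s) y, EuclideanSpace.single 2 1⟫_ℝ = 0) →
      (∀ s < 0, ∀ y, ⟪fderiv ℝ (v s) y (Literature.Analysis.FluidPDE.curl (v s) y), EuclideanSpace.single 2 1⟫_ℝ = 0) →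
      (∀ s < 0, AnalyticOnNhd ℝ (v s) Set.univ) →
      ∀ W : Set (ℝ × EuclideanSpace ℝ (Fin 3)), IsOpen W → W.Nonempty → W ⊆ Set.Iio (0 : ℝ) ×ˢ Set.univ →
        (∀ z ∈ W, Literature.Analysis.FluidPDE.curl (v z.1) z.2 ≠ 0 ∧
          (fderiv ℝ (v z.1) z.2 (EuclideanSpace.single 0 1) 2 ≠ 0 ∨ fderiv ℝ (v z.1) z.2 (EuclideanSpace.single 1 1) 2 ≠ 0) ∧
          (fderiv ℝ (v z.1) z.2 (EuclideanSpace.single 2 1) 0 ≠ 0 ∨ fderiv ℝ (v z.1) z.2 (EuclideanSpace.single 2 1) 1 ≠ 0)) →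
        (∀ m : ℝ → ℝ, ∀ W₁ : Set (ℝ × EuclideanSpace ℝ (Fin 3)), W₁ ⊆ W → IsOpen W₁ → W₁.Nonempty →
          ∃ z ∈ W₁, ∃ b : Fin 3, b ≠ 2 ∧
            fderiv ℝ (v z.1) z.2 (EuclideanSpace.single 2 1) b ≠
              m z.1 * fderiv ℝ (v z.1) z.2 (EuclideanSpace.single b 1) 2) →
        (∀ z ∈ W,
          fderiv ℝ (fun x => fderiv ℝ (v z.1) x (EuclideanSpace.single 2 1) 2) z.2 (EuclideanSpace.single 0 1) *
              fderiv ℝ (v z.1) z.2 (EuclideanSpace.single 1 1) 2 -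
            fderiv ℝ (fun x => fderiv ℝ (v z.1) x (EuclideanSpace.single 2 1) 2) z.2 (EuclideanSpace.single 1 1) *
              fderiv ℝ (v z.1) z.2 (EuclideanSpace.single 0 1) 2 ≠ 0) →
        ¬ Literature.Analysis.FluidPDE.IsBackwardSingularPoint v 0) := by
  intro H
  exact H 10 twistProfile hasTypeITimeDecay_twistProfile continuousOn_twistProfile
    (fun t _ => isDivFree_twistProfile t) (fun s _ y => poloidal_twistProfile s y)
    (fun s _ y => frozen_twistProfile s y) (fun s _ => analyticOnNhd_twistProfile s) twistWindow isOpen_twistWindow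
    twistWindow_nonempty twistWindow_subset twistProfile_pins
    (fun m W₁ hW₁ hW₁o hW₁n => twistProfile_slope_not_time_only m W₁ hW₁ hW₁o hW₁n)
    twistProfile_twist_ne_zero isBackwardSingularPoint_twistProfile

end Summit.NavierStokesRegularity.NavierStokesRegularity.Theorems.PoloidalWindowRigidity.Negative

end
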